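import Mathlib
import HarnessLib

/-!
# Peyrl–Parrilo rounding and projection: exact rational Gram matrices from numerical ones

[PeyrlParrilo2008, §3] turns a floating-point Gram matrix `Q` of an SOS program (interior-point
output, satisfying the coefficient constraints only approximately) into an EXACT certificate:
round `Q` to a rational `Q̃`, then project `Q̃` orthogonally onto the affine space
`L = {Q | Σ_{β+γ=α} Q_{βγ} = p_α ∀ α}` of exact Gram matrices of `p` [PeyrlParrilo2008, (6)].

* **Proposition 7** (projection formula): `Π(Q)_{βγ} = Q_{βγ} − e_{β+γ} / n(β+γ)`, where
  `e_α = Σ_{β'+γ'=α} Q_{β'γ'} − p_α` is the error in the coefficient of `x^α` and `n(α)` the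
  number of pairs `(β', γ')` with `β' + γ' = α`; it uses only field operations, so `Π(Q̃)` is
  rational when `Q̃` and `p` are.
* **Proposition 8** (a-priori guarantee): if the true solution satisfies `Q ⪰ ε I` (`ε > 0`),
  `d(Q, Π(Q)) ≤ δ` and the rounding error is `d(Q, Q̃) ≤ τ` (Frobenius distances) with
  `τ² + δ² ≤ ε²`, then `Π(Q̃) ⪰ 0` — an exact rational SOS certificate.
* **Proposition 9** (image representation `Q(y) = G₀ + Σ_i y_i G_i`): if `Q(y) ⪰ ε I` and
  `|y_i − ỹ_i| ≤ τ` with `τ Σ_i σ̄(G_i) ≤ ε` then `Q(ỹ) ⪰ 0`.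

## What is formalised (namespace `Literature.Algebra.Polynomial.RationalSosRounding`)

The constraints (6) only see the entries of `Q` through the CLASSES `{(β, γ) | β + γ = α}`; we
formalise Prop. 7/8 for an arbitrary class map `cls : k → k → γ` on a finite index type `k` and
right-hand side `b : γ → 𝕜` over a field `𝕜` (for SOS: `k` = the exponents of degree `≤ d`,
`cls β γ = β + γ`, `b = ` the coefficients of `p`; the bridge to polynomials is
`Literature.Algebra.Polynomial.GramMatrixMethod.coeff_gramPoly_monomialVec`):
* `classSum cls Q a = Σ_{cls i j = a} Q_{ij}`, `classCount cls a = n(a)`,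
  `gramAffineSpace cls b = {Q | ∀ a, classSum cls Q a = b a}` (the space `L`),
  `residual cls b Q a = e_a`, `proj cls b Q` (the matrix `Π(Q)` of Prop. 7),
  `frobInner`, `frobSq` (Frobenius inner product and squared Frobenius norm `d(·,0)²`).
* Prop. 7: `proj_mem_gramAffineSpace` (Π(Q) ∈ L, given the solvability condition
  `b a = 0` on empty classes, i.e. `supp p ⊆ S + S`), `frobInner_sub_proj_eq_zero` (Q − Π(Q) ⟂ L − L),
  `frobSq_sub_proj_le` (Π(Q) is the nearest point of `L`), `proj_sub_proj` / `frobSq_proj_zero_le`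
  (Π is affine with a non-expansive linear part).
* Prop. 8: `frobSq_proj_sub_le` (`d(Π(Q̃), Q)² ≤ δ² + τ²`, Pythagoras),
  `sq_dotProduct_mulVec_le_frobSq` (`(xᵀ E x)² ≤ ‖E‖_F² ‖x‖⁴`, the eigenvalue bound
  `|λ_i(E)| ≤ d(E, 0)`), and the theorem `posSemidef_proj_of_rounding` (`Π(Q̃) ⪰ 0` and `Π(Q̃) ∈ L`),
  stated over any linearly ordered field with trivial involution (`ℚ`, `ℝ`), sqrt-free.
* Prop. 9: `posSemidef_image_of_rounding`, with the spectral bound `σ̄(G_i)` abstracted to any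
  constants `c_i` with `|xᵀ G_i x| ≤ c_i ‖x‖²`.

## References

* [PeyrlParrilo2008] H. Peyrl, P. A. Parrilo, *Computing sum of squares decompositions with
  rational coefficients*, Theoret. Comput. Sci. 409 (2008) 269–281, §2.2.2 (6), §3.1 Prop. 7,
  Prop. 8, §3.2 Prop. 9, Appendix A.

No named facts; everything here is proved.
-/

noncomputable section

open Matrix Finset

open scoped BigOperators

namespace Literature.Algebra.Polynomial.RationalSosRounding

universe u v w

variable {𝕜 : Type u} [Field 𝕜] {k : Type v} {γ : Type w} [Fintype k] [DecidableEq γ]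

/-! ### The affine space `L` of exact Gram matrices, by entry classes -/

/-- The class sums `A(Q)_a = Σ_{(i,j) : cls i j = a} Q_{ij}` — for SOS, `Σ_{β+γ=α} Q_{βγ}`, the
coefficient of `x^α` in `zᵀ Q z`. [cite: PeyrlParrilo2008, §2.2.2 (6)] -/
def classSum (cls : k → k → γ) (Q : Matrix k k 𝕜) (a : γ) : 𝕜 :=
  ∑ i, ∑ j, if cls i j = a then Q i j else 0

/-- `n(a)` = the number of index pairs in the class of `a`.
[cite: PeyrlParrilo2008, §3.1 Prop. 7 (n(α+β))] -/
def classCount (cls : k → k → γ) (a : γ) : ℕ :=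
  (Finset.univ.filter fun ij : k × k => cls ij.1 ij.2 = a).card

/-- The affine space `L = {Q | Σ_{cls i j = a} Q_{ij} = b_a ∀ a}` of exact Gram matrices (kernel /
implicit representation). [cite: PeyrlParrilo2008, §2.2.2 (6)] -/
def gramAffineSpace (cls : k → k → γ) (b : γ → 𝕜) : Set (Matrix k k 𝕜) :=
  {Q | ∀ a, classSum cls Q a = b a}

/-- The coefficient errors `e_a = Σ_{cls i j = a} Q_{ij} − b_a`.
[cite: PeyrlParrilo2008, §3.1 Prop. 7 (e_{α+β})] -/
def residual (cls : k → k → γ) (b : γ → 𝕜) (Q : Matrix k k 𝕜) (a : γ) : 𝕜 :=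
  classSum cls Q a - b a

/-- **The projection of Prop. 7**: `Π(Q)_{ij} = Q_{ij} − e_{cls i j} / n(cls i j)` — subtract from
each entry the error of its class divided by the class size.  Only field operations: rational in,
rational out. [cite: PeyrlParrilo2008, §3.1 Prop. 7] -/
def proj (cls : k → k → γ) (b : γ → 𝕜) (Q : Matrix k k 𝕜) : Matrix k k 𝕜 :=
  Matrix.of fun i j => Q i j - residual cls b Q (cls i j) / (classCount cls (cls i j) : 𝕜)

/-- The Frobenius (trace) inner product `⟪A, B⟫ = Σ_{ij} A_{ij} B_{ij}`.
[cite: PeyrlParrilo2008, §3.1 (Euclidean distance between two matrices)] -/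
def frobInner (A B : Matrix k k 𝕜) : 𝕜 := ∑ i, ∑ j, A i j * B i j

/-- The squared Frobenius norm `d(A, 0)² = Σ_{ij} A_{ij}²` (so `d(A, B)² = frobSq (A - B)`).
[cite: PeyrlParrilo2008, §3.1 (Euclidean distance between two matrices)] -/
def frobSq (A : Matrix k k 𝕜) : 𝕜 := frobInner A A

/-! ### Elementary properties -/

omit [DecidableEq γ] in
/-- Entries of `proj`. [folklore] -/
@[simp] private theorem proj_apply [DecidableEq γ] (cls : k → k → γ) (b : γ → 𝕜)
    (Q : Matrix k k 𝕜) (i j : k) :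
    proj cls b Q i j = Q i j - residual cls b Q (cls i j) / (classCount cls (cls i j) : 𝕜) := rfl

/-- `classSum` is additive. [folklore] -/
private theorem classSum_sub (cls : k → k → γ) (Q Q' : Matrix k k 𝕜) (a : γ) :
    classSum cls (Q - Q') a = classSum cls Q a - classSum cls Q' a := by
  simp only [classSum, ← Finset.sum_sub_distrib]
  refine Finset.sum_congr rfl fun i _ => Finset.sum_congr rfl fun j _ => ?_
  split_ifs <;> simp [Matrix.sub_apply]

/-- `classSum` is additive. [folklore] -/
private theorem classSum_add (cls : k → k → γ) (Q Q' : Matrix k k 𝕜) (a : γ) :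
    classSum cls (Q + Q') a = classSum cls Q a + classSum cls Q' a := by
  simp only [classSum, ← Finset.sum_add_distrib]
  refine Finset.sum_congr rfl fun i _ => Finset.sum_congr rfl fun j _ => ?_
  split_ifs <;> simp [Matrix.add_apply]

/-- `n(a)` as a field element is the class indicator sum. [folklore] -/
private theorem cast_classCount (cls : k → k → γ) (a : γ) :
    (classCount cls a : 𝕜) = ∑ i, ∑ j, if cls i j = a then (1 : 𝕜) else 0 := by
  rw [classCount, Finset.card_filter, Nat.cast_sum, Fintype.sum_prod_type]
  refine Finset.sum_congr rfl fun i _ => Finset.sum_congr rfl fun j _ => ?_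
  split_ifs <;> simp

omit [DecidableEq γ] in
/-- Every class that occurs is nonempty: `n(cls i j) ≥ 1`. [folklore] -/
private theorem classCount_pos [DecidableEq γ] (cls : k → k → γ) (i j : k) :
    0 < classCount cls (cls i j) :=
  Finset.card_pos.2 ⟨(i, j), Finset.mem_filter.2 ⟨Finset.mem_univ _, rfl⟩⟩

/-- A class with `n(a) = 0` does not occur. [folklore] -/
private theorem forall_ne_of_classCount_eq_zero {cls : k → k → γ} {a : γ}
    (h : classCount cls a = 0) (i j : k) : cls i j ≠ a := by
  intro hij
  have := classCount_pos cls i j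
  rw [hij, h] at this
  exact lt_irrefl 0 this

/-- The class sum over a class that does not occur is `0`. [folklore] -/
private theorem classSum_eq_zero_of_classCount_eq_zero {cls : k → k → γ} {a : γ}
    (h : classCount cls a = 0) (Q : Matrix k k 𝕜) : classSum cls Q a = 0 :=
  Finset.sum_eq_zero fun i _ => Finset.sum_eq_zero fun j _ =>
    if_neg (forall_ne_of_classCount_eq_zero h i j)

/-- The set of classes that occur. [folklore] -/
private def classRange (cls : k → k → γ) : Finset γ :=
  (Finset.univ : Finset (k × k)).image fun ij => cls ij.1 ij.2

/-- **Summation by classes**: a sum of `f(cls i j) · Δ_{ij}` over all entries is the sum over the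
occurring classes of `f(a) · A(Δ)_a`. [folklore] -/
private theorem sum_apply_cls_mul (cls : k → k → γ) (f : γ → 𝕜) (Δ : Matrix k k 𝕜) :
    ∑ i, ∑ j, f (cls i j) * Δ i j = ∑ a ∈ classRange cls, f a * classSum cls Δ a := by
  symm
  calc ∑ a ∈ classRange cls, f a * classSum cls Δ a
      = ∑ a ∈ classRange cls, ∑ i, ∑ j, (if cls i j = a then f a * Δ i j else 0) := by
        refine Finset.sum_congr rfl fun a _ => ?_
        simp only [classSum, Finset.mul_sum, mul_ite, mul_zero]
    _ = ∑ i, ∑ a ∈ classRange cls, ∑ j, (if cls i j = a then f a * Δ i j else 0) :=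
        Finset.sum_comm
    _ = ∑ i, ∑ j, ∑ a ∈ classRange cls, (if cls i j = a then f a * Δ i j else 0) :=
        Finset.sum_congr rfl fun i _ => Finset.sum_comm
    _ = ∑ i, ∑ j, f (cls i j) * Δ i j := by
        refine Finset.sum_congr rfl fun i _ => Finset.sum_congr rfl fun j _ => ?_
        rw [Finset.sum_ite_eq]
        exact if_pos (Finset.mem_image.2 ⟨(i, j), Finset.mem_univ _, rfl⟩)

/-- Pythagoras / polarisation for the Frobenius form. [folklore] -/
private theorem frobSq_add (A B : Matrix k k 𝕜) :
    frobSq (A + B) = frobSq A + 2 * frobInner A B + frobSq B := by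
  have h : ∀ i j, (A i j + B i j) * (A i j + B i j) =
      A i j * A i j + 2 * (A i j * B i j) + B i j * B i j := fun i j => by ring
  simp only [frobSq, frobInner, Matrix.add_apply, h, Finset.sum_add_distrib, Finset.mul_sum]

omit [DecidableEq γ] in
/-- Symmetry of the Frobenius form. [folklore] -/
private theorem frobInner_comm (A B : Matrix k k 𝕜) : frobInner A B = frobInner B A := by
  simp only [frobInner, mul_comm]

omit [DecidableEq γ] in
/-- `d(A, B) = d(B, A)`. [folklore] -/
private theorem frobSq_sub_comm (A B : Matrix k k 𝕜) : frobSq (A - B) = frobSq (B - A) := by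
  simp only [frobSq, frobInner, Matrix.sub_apply]
  refine Finset.sum_congr rfl fun i _ => Finset.sum_congr rfl fun j _ => by ring

omit [DecidableEq γ] in
/-- `frobInner (-A) B = - frobInner A B`. [folklore] -/
private theorem frobInner_neg_left (A B : Matrix k k 𝕜) : frobInner (-A) B = -frobInner A B := by
  simp only [frobInner, Matrix.neg_apply, neg_mul, Finset.sum_neg_distrib]

/-! ### Proposition 7: `Π` is the orthogonal projection onto `L` -/

section Prop7

variable [CharZero 𝕜]

/-- **[PeyrlParrilo2008, Prop. 7 (i)]**: `Π(Q) ∈ L`, i.e. `Σ_{cls i j = a} Π(Q)_{ij} = b_a` for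
every `a` — provided the system is solvable on empty classes (`b_a = 0` whenever no pair has class
`a`; for SOS: `supp p ⊆ S + S`).  Proof: the class-`a` entries each lose `e_a / n(a)`, `n(a)` of
them. [cite: PeyrlParrilo2008, §3.1 Prop. 7 and Appendix A (i)] -/
theorem proj_mem_gramAffineSpace (cls : k → k → γ) {b : γ → 𝕜}
    (hb : ∀ a, classCount cls a = 0 → b a = 0) (Q : Matrix k k 𝕜) :
    proj cls b Q ∈ gramAffineSpace cls b := by
  intro a
  have key : classSum cls (proj cls b Q) a = classSum cls Q a -
      residual cls b Q a / (classCount cls a : 𝕜) * ∑ i, ∑ j, (if cls i j = a then (1 : 𝕜) else 0) := by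
    rw [Finset.mul_sum, classSum, classSum, ← Finset.sum_sub_distrib]
    refine Finset.sum_congr rfl fun i _ => ?_
    rw [Finset.mul_sum, ← Finset.sum_sub_distrib]
    refine Finset.sum_congr rfl fun j _ => ?_
    by_cases h : cls i j = a
    · subst h; simp
    · simp [h]
  rw [key, ← cast_classCount]
  by_cases hn : classCount cls a = 0
  · rw [hb a hn, classSum_eq_zero_of_classCount_eq_zero hn, hn, Nat.cast_zero, mul_zero, sub_zero]
  · rw [div_mul_cancel₀ _ (Nat.cast_ne_zero.2 hn), residual]
    ring

omit [CharZero 𝕜] in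
/-- **[PeyrlParrilo2008, Prop. 7 (ii)]**: `Q − Π(Q)` is orthogonal to the direction space of `L`
(the kernel `{Δ | Σ_{cls i j = a} Δ_{ij} = 0 ∀ a}`), since `Q − Π(Q)` is constant `= e_a/n(a)` on
each class. [cite: PeyrlParrilo2008, §3.1 Prop. 7 and Appendix A (ii)] -/
theorem frobInner_sub_proj_eq_zero (cls : k → k → γ) (b : γ → 𝕜) (Q : Matrix k k 𝕜)
    {Δ : Matrix k k 𝕜} (hΔ : ∀ a, classSum cls Δ a = 0) :
    frobInner (Q - proj cls b Q) Δ = 0 := by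
  calc frobInner (Q - proj cls b Q) Δ
      = ∑ i, ∑ j, (fun a => residual cls b Q a / (classCount cls a : 𝕜)) (cls i j) * Δ i j := by
        refine Finset.sum_congr rfl fun i _ => Finset.sum_congr rfl fun j _ => ?_
        rw [Matrix.sub_apply, proj_apply, sub_sub_cancel]
    _ = ∑ a ∈ classRange cls, residual cls b Q a / (classCount cls a : 𝕜) * classSum cls Δ a :=
        sum_apply_cls_mul cls (fun a => residual cls b Q a / (classCount cls a : 𝕜)) Δ
    _ = 0 := Finset.sum_eq_zero fun a _ => by rw [hΔ a, mul_zero]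

omit [CharZero 𝕜] in
/-- `Π` is affine: `Π_b(Q̃) − Π_b(Q) = Π_0(Q̃ − Q)`, the linear projection onto the direction space.
[cite: PeyrlParrilo2008, §3.1 Prop. 8 (proof: "the projection onto L is orthogonal")] -/
theorem proj_sub_proj (cls : k → k → γ) (b : γ → 𝕜) (Q Q' : Matrix k k 𝕜) :
    proj cls b Q' - proj cls b Q = proj cls 0 (Q' - Q) := by
  ext i j
  simp only [Matrix.sub_apply, proj_apply, residual, classSum_sub, Pi.zero_apply, sub_zero]
  ring

end Prop7

section Ordered

variable [LinearOrder 𝕜] [IsStrictOrderedRing 𝕜]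

omit [DecidableEq γ] in
/-- `d(A, 0)² ≥ 0`. [folklore] -/
private theorem frobSq_nonneg (A : Matrix k k 𝕜) : 0 ≤ frobSq A :=
  Finset.sum_nonneg fun _ _ => Finset.sum_nonneg fun _ _ => mul_self_nonneg _

/-- **`Π(Q)` is the nearest point of `L`** (so `Π` is the orthogonal projection onto `L`):
`d(Q, Π(Q)) ≤ d(Q, Q')` for every `Q' ∈ L`, by Pythagoras from Prop. 7 (i), (ii).
[cite: PeyrlParrilo2008, §3.1 Prop. 7] -/
theorem frobSq_sub_proj_le (cls : k → k → γ) {b : γ → 𝕜}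
    (hb : ∀ a, classCount cls a = 0 → b a = 0) (Q : Matrix k k 𝕜) {Q' : Matrix k k 𝕜}
    (hQ' : Q' ∈ gramAffineSpace cls b) :
    frobSq (Q - proj cls b Q) ≤ frobSq (Q - Q') := by
  have hsplit : Q - Q' = (Q - proj cls b Q) + (proj cls b Q - Q') := by abel
  have horth : frobInner (Q - proj cls b Q) (proj cls b Q - Q') = 0 :=
    frobInner_sub_proj_eq_zero cls b Q fun a => by
      rw [classSum_sub, proj_mem_gramAffineSpace cls hb Q a, hQ' a, sub_self]
  rw [hsplit, frobSq_add, horth, mul_zero, add_zero]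
  exact le_add_of_nonneg_right (frobSq_nonneg _)

/-- **The linear part of `Π` is non-expansive**: `d(Π_0(Δ), 0) ≤ d(Δ, 0)` (orthogonal projection
onto the direction space). [cite: PeyrlParrilo2008, §3.1 Prop. 8 (proof: d(Π(Q̃), Π(Q)) ≤ d(Q̃, Q))] -/
theorem frobSq_proj_zero_le (cls : k → k → γ) (Δ : Matrix k k 𝕜) :
    frobSq (proj cls 0 Δ) ≤ frobSq Δ := by
  have hsplit : Δ = (Δ - proj cls 0 Δ) + proj cls 0 Δ := by abel
  have horth : frobInner (Δ - proj cls 0 Δ) (proj cls 0 Δ) = 0 :=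
    frobInner_sub_proj_eq_zero cls 0 Δ fun a =>
      proj_mem_gramAffineSpace cls (b := 0) (fun _ _ => rfl) Δ a
  conv_rhs => rw [hsplit]
  rw [frobSq_add, horth, mul_zero, add_zero]
  exact le_add_of_nonneg_left (frobSq_nonneg _)

/-- **[PeyrlParrilo2008, Prop. 8, distance estimate]**: if `d(Q, Π(Q))² ≤ δ²` and `d(Q̃, Q)² ≤ τ²`
then `d(Π(Q̃), Q)² ≤ δ² + τ²` (Pythagoras: `Q − Π(Q) ⟂ Π(Q̃) − Π(Q)`, and
`d(Π(Q̃), Π(Q)) ≤ d(Q̃, Q)`). [cite: PeyrlParrilo2008, §3.1 Prop. 8 (proof)] -/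
theorem frobSq_proj_sub_le (cls : k → k → γ) {b : γ → 𝕜}
    (hb : ∀ a, classCount cls a = 0 → b a = 0) {Q Q' : Matrix k k 𝕜} {δsq τsq : 𝕜}
    (hδ : frobSq (Q - proj cls b Q) ≤ δsq) (hτ : frobSq (Q' - Q) ≤ τsq) :
    frobSq (proj cls b Q' - Q) ≤ δsq + τsq := by
  have hsplit : proj cls b Q' - Q = -(Q - proj cls b Q) + (proj cls b Q' - proj cls b Q) := by abel
  have horth : frobInner (-(Q - proj cls b Q)) (proj cls b Q' - proj cls b Q) = 0 := by
    rw [frobInner_neg_left, neg_eq_zero]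
    exact frobInner_sub_proj_eq_zero cls b Q fun a => by
      rw [classSum_sub, proj_mem_gramAffineSpace cls hb Q' a, proj_mem_gramAffineSpace cls hb Q a,
        sub_self]
  have hneg : frobSq (-(Q - proj cls b Q)) = frobSq (Q - proj cls b Q) := by
    rw [neg_sub, frobSq_sub_comm]
  rw [hsplit, frobSq_add, horth, mul_zero, add_zero, hneg, proj_sub_proj]
  exact add_le_add hδ ((frobSq_proj_zero_le cls _).trans hτ)

omit [DecidableEq γ] in
/-- **Eigenvalue bound by the Frobenius norm**, quadratic-form version:
`(xᵀ E x)² ≤ d(E, 0)² · (xᵀ x)²` (Cauchy–Schwarz for `xᵀ E x = ⟪E, x xᵀ⟫`), i.e.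
`|λ_i(E)| ≤ d(E, 0)`. [cite: PeyrlParrilo2008, §3.1 Prop. 8 (proof: |λᵢ(·)| ≤ d(·, 0))] -/
theorem sq_dotProduct_mulVec_le_frobSq (E : Matrix k k 𝕜) (x : k → 𝕜) :
    (x ⬝ᵥ E *ᵥ x) ^ 2 ≤ frobSq E * (x ⬝ᵥ x) ^ 2 := by
  have h1 : x ⬝ᵥ E *ᵥ x = ∑ p : k × k, E p.1 p.2 * (x p.1 * x p.2) := by
    rw [Fintype.sum_prod_type]
    simp only [dotProduct, mulVec, Finset.mul_sum]
    exact Finset.sum_congr rfl fun i _ => Finset.sum_congr rfl fun j _ => by ring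
  have h2 : frobSq E = ∑ p : k × k, E p.1 p.2 ^ 2 := by
    rw [Fintype.sum_prod_type]
    simp only [frobSq, frobInner, sq]
  have h3 : (x ⬝ᵥ x) ^ 2 = ∑ p : k × k, (x p.1 * x p.2) ^ 2 := by
    rw [Fintype.sum_prod_type, sq, dotProduct, Finset.sum_mul_sum]
    exact Finset.sum_congr rfl fun i _ => Finset.sum_congr rfl fun j _ => by ring
  rw [h1, h2, h3]
  exact Finset.sum_mul_sq_le_sq_mul_sq _ _ _

omit [DecidableEq γ] in
/-- `xᵀ x ≥ 0`. [folklore] -/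
private theorem dotProduct_self_nonneg' (x : k → 𝕜) : 0 ≤ x ⬝ᵥ x :=
  Finset.sum_nonneg fun _ _ => mul_self_nonneg _

omit [DecidableEq γ] in
/-- `Q ⪰ ε I` in quadratic-form terms: `xᵀ Q x ≥ ε · xᵀ x`. [folklore] -/
private theorem le_dotProduct_mulVec_of_posSemidef_sub_smul [StarRing 𝕜] [TrivialStar 𝕜]
    [DecidableEq k] {Q : Matrix k k 𝕜} {ε : 𝕜} (hQε : (Q - ε • (1 : Matrix k k 𝕜)).PosSemidef)
    (x : k → 𝕜) : ε * (x ⬝ᵥ x) ≤ x ⬝ᵥ Q *ᵥ x := by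
  have h := hQε.dotProduct_mulVec_nonneg x
  rw [star_trivial, sub_mulVec, dotProduct_sub, smul_mulVec, one_mulVec, dotProduct_smul,
    smul_eq_mul, sub_nonneg] at h
  exact h

/-! ### Proposition 8: the rounded-and-projected Gram matrix is positive semidefinite -/

/-- **[PeyrlParrilo2008, Prop. 8] (validity of rounding + projection).**  Let the classes be
symmetric (`cls i j = cls j i`, as `β + γ = γ + β`) and the system solvable on empty classes.  Let
`Q ⪰ ε I` with `ε ≥ 0` be a (numerical, strictly feasible) solution with `d(Q, Π(Q))² ≤ δ²`, and let
`Q̃` be a symmetric (e.g. rational) approximation with `d(Q̃, Q)² ≤ τ²`.  If `τ² + δ² ≤ ε²` then the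
projection `Π(Q̃)` is positive semidefinite and lies in `L` — an exact Gram matrix, hence a valid
SOS decomposition.  Proof: `d(Π(Q̃), Q)² ≤ δ² + τ² ≤ ε²` and `xᵀ Π(Q̃) x ≥ xᵀ Q x − d(Π(Q̃), Q)·xᵀx
≥ (ε − ε) xᵀ x = 0`.  Stated over any linearly ordered field with trivial involution (`ℚ`, `ℝ`);
no square roots. [cite: PeyrlParrilo2008, §3.1 Prop. 8] -/
theorem posSemidef_proj_of_rounding [StarRing 𝕜] [TrivialStar 𝕜] [DecidableEq k]
    {cls : k → k → γ} (hcls : ∀ i j, cls i j = cls j i) {b : γ → 𝕜}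
    (hb : ∀ a, classCount cls a = 0 → b a = 0) {Q Q' : Matrix k k 𝕜} {ε δ τ : 𝕜} (hε : 0 ≤ ε)
    (hQε : (Q - ε • (1 : Matrix k k 𝕜)).PosSemidef) (hQ' : Q'.IsHermitian)
    (hδ : frobSq (Q - proj cls b Q) ≤ δ ^ 2) (hτ : frobSq (Q' - Q) ≤ τ ^ 2)
    (h : τ ^ 2 + δ ^ 2 ≤ ε ^ 2) :
    (proj cls b Q').PosSemidef ∧ proj cls b Q' ∈ gramAffineSpace cls b := by
  refine ⟨Matrix.PosSemidef.of_dotProduct_mulVec_nonneg ?_ fun x => ?_,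
    proj_mem_gramAffineSpace cls hb Q'⟩
  · -- symmetry of `Π(Q̃)`
    refine Matrix.IsHermitian.ext fun i j => ?_
    have hji : Q' j i = Q' i j := by simpa only [star_trivial] using hQ'.apply i j
    rw [star_trivial, proj_apply, proj_apply, hji, hcls j i]
  · -- the quadratic form
    set E := proj cls b Q' - Q with hE
    have hEfrob : frobSq E ≤ ε ^ 2 :=
      (frobSq_proj_sub_le cls hb hδ hτ).trans ((add_comm _ _).trans_le h)
    have hquad : (x ⬝ᵥ E *ᵥ x) ^ 2 ≤ (ε * (x ⬝ᵥ x)) ^ 2 := by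
      rw [mul_pow]
      exact (sq_dotProduct_mulVec_le_frobSq E x).trans
        (mul_le_mul_of_nonneg_right hEfrob (sq_nonneg _))
    have habs : |x ⬝ᵥ E *ᵥ x| ≤ ε * (x ⬝ᵥ x) :=
      abs_le_of_sq_le_sq hquad (mul_nonneg hε (dotProduct_self_nonneg' x))
    have hsplit : proj cls b Q' = Q + E := by rw [hE]; abel
    rw [star_trivial, hsplit, add_mulVec, dotProduct_add]
    have hQx := le_dotProduct_mulVec_of_posSemidef_sub_smul hQε x
    have hEx := neg_le_of_abs_le habs
    linarith

/-! ### Proposition 9: rounding in the image representation -/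

/-- **[PeyrlParrilo2008, Prop. 9] (image representation).**  For `Q(y) = G₀ + Σ_i y_i G_i` with
symmetric `G₀, G_i` and constants `c_i` bounding the quadratic forms of the `G_i`
(`|xᵀ G_i x| ≤ c_i xᵀ x`, e.g. `c_i = σ̄(G_i)` the spectral radius): if `Q(y) ⪰ ε I` and the
rounded parameters satisfy `|ỹ_i − y_i| ≤ τ` with `τ Σ_i c_i ≤ ε`, then `Q(ỹ) ⪰ 0`; since the
identity `p = zᵀ Q(y) z` holds for every `y`, `Q(ỹ)` is an exact certificate.
[cite: PeyrlParrilo2008, §3.2 Prop. 9] -/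
theorem posSemidef_image_of_rounding [StarRing 𝕜] [TrivialStar 𝕜] [DecidableEq k] {ι : Type*}
    [Fintype ι] {G₀ : Matrix k k 𝕜} {G : ι → Matrix k k 𝕜} (hG₀ : G₀.IsHermitian)
    (hG : ∀ i, (G i).IsHermitian) {c : ι → 𝕜} (hc : ∀ i x, |x ⬝ᵥ G i *ᵥ x| ≤ c i * (x ⬝ᵥ x))
    {y y' : ι → 𝕜} {ε τ : 𝕜}
    (hQε : (G₀ + ∑ i, y i • G i - ε • (1 : Matrix k k 𝕜)).PosSemidef)
    (hy : ∀ i, |y' i - y i| ≤ τ) (h : τ * ∑ i, c i ≤ ε) :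
    (G₀ + ∑ i, y' i • G i).PosSemidef := by
  refine Matrix.PosSemidef.of_dotProduct_mulVec_nonneg ?_ fun x => ?_
  · -- symmetry
    change (G₀ + ∑ i, y' i • G i)ᴴ = G₀ + ∑ i, y' i • G i
    rw [conjTranspose_add, conjTranspose_sum, hG₀.eq]
    refine congrArg _ (Finset.sum_congr rfl fun i _ => ?_)
    rw [conjTranspose_smul, star_trivial, (hG i).eq]
  · have hsplit : G₀ + ∑ i, y' i • G i =
        (G₀ + ∑ i, y i • G i) + ∑ i, (y' i - y i) • G i := by
      rw [add_assoc, ← Finset.sum_add_distrib]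
      refine congrArg _ (Finset.sum_congr rfl fun i _ => ?_)
      rw [← add_smul]; congr 1; ring
    have hquad : ∀ i, -(τ * c i * (x ⬝ᵥ x)) ≤ (y' i - y i) * (x ⬝ᵥ G i *ᵥ x) := by
      intro i
      have hxx := dotProduct_self_nonneg' (𝕜 := 𝕜) x
      have h1 : |(y' i - y i) * (x ⬝ᵥ G i *ᵥ x)| ≤ τ * (c i * (x ⬝ᵥ x)) := by
        rw [abs_mul]
        exact mul_le_mul (hy i) (hc i x) (abs_nonneg _) ((abs_nonneg _).trans (hy i))
      have := neg_le_of_abs_le h1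
      linarith
    rw [star_trivial, hsplit, add_mulVec, dotProduct_add, sum_mulVec, dotProduct_sum]
    simp only [smul_mulVec, dotProduct_smul, smul_eq_mul]
    have hQx := le_dotProduct_mulVec_of_posSemidef_sub_smul hQε x
    have hsum : -(τ * (∑ i, c i) * (x ⬝ᵥ x)) ≤ ∑ i, (y' i - y i) * (x ⬝ᵥ G i *ᵥ x) := by
      have := Finset.sum_le_sum fun i (_ : i ∈ Finset.univ) => hquad i
      rw [Finset.sum_neg_distrib, ← Finset.sum_mul, ← Finset.mul_sum] at this
      exact this
    have hxx := dotProduct_self_nonneg' (𝕜 := 𝕜) x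
    have hτε : τ * (∑ i, c i) * (x ⬝ᵥ x) ≤ ε * (x ⬝ᵥ x) := mul_le_mul_of_nonneg_right h hxx
    linarith

end Ordered

/-! ### Tests / usage templates (kernel-checked) -/

section Tests

/-- Test (Prop. 7 on a `2 × 2` toy system with classes `i + j ∈ {0, 1, 2}` — the univariate SOS
constraints for `p = b₀ + b₁ x + b₂ x²` in the basis `(1, x)`): the projection of any rational `Q`
satisfies the constraints exactly. [folklore] -/
example (Q : Matrix (Fin 2) (Fin 2) ℚ) (b : ℕ → ℚ) (hb : ∀ a, 3 ≤ a → b a = 0) :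
    proj (fun i j : Fin 2 => (i : ℕ) + j) b Q ∈ gramAffineSpace (fun i j : Fin 2 => (i : ℕ) + j) b := by
  refine proj_mem_gramAffineSpace _ (fun a ha => hb a ?_) Q
  by_contra hlt
  interval_cases a
  · exact absurd ha (Nat.pos_iff_ne_zero.1 (classCount_pos (fun i j : Fin 2 => (i : ℕ) + j) 0 0))
  · exact absurd ha (Nat.pos_iff_ne_zero.1 (classCount_pos (fun i j : Fin 2 => (i : ℕ) + j) 0 1))
  · exact absurd ha (Nat.pos_iff_ne_zero.1 (classCount_pos (fun i j : Fin 2 => (i : ℕ) + j) 1 1))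

end Tests

end Literature.Algebra.Polynomial.RationalSosRounding
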